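import Mathlib
import Literature.Analysis.FluidPDE.Tao2016AveragedNS.ShiftSetCascadeFlows
import Summits.NavierStokesRegularity.NavierStokesRegularity.Theorems.TaoLadderRungTwoFlatCertificateGlueMeshOn
import HarnessLib

/-!
# Certificate glue on a shift set `𝕊`, X-b: MESH SOUNDNESS WITH A LANDING WINDOW — the landing clause of the
  A♭ window certificate when the section crossing may happen in any step of a window `j₁ … j₂`
  (helper for item stmt-NavierStokesRegularity-22987 `FlatGapCertificatesV2`, crux K_A♭ of route
  TaoLadderRungTwoFlat; cell harvest/h2-tao-ladder, p1 g14)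

Glue X (`hland_of_mesh`) reads the landing out in ONE mesh step `ℓ`; the readout clauses are then required on
`Hull ℓ ∩ {sec = lev}`, a set whose extent along the flow is the step length times the speed. To keep that set
thin while the crossing times of the trajectories from a fat start box spread over a window, the certificate
covers the crossing window by several SHORT steps `j₁ … j₂` and states the static readout on each
`Hull j ∩ {sec = lev}`: `hland_of_mesh_window` (intermediate value theorem on `[t j₁, t (j₂+1)]`, then the step
containing the crossing time is located on the mesh). Everything else as in glue X.

HONEST FRAMING: Tao-type MODEL lattices (Tao 2016 §4/§6 vocabulary, shift-set parametrised); the mesh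
certificate is a HYPOTHESIS — nothing is computed or certified here, no stub is closed, and nothing here is a
statement about the Navier–Stokes equations.
-/

noncomputable section

-- the sub-problem namespace repeats the summit name by design (D-0017)
set_option linter.dupNamespace false

namespace Summit.NavierStokesRegularity.NavierStokesRegularity.Theorems

open Set Filter Topology Literature.Analysis.FluidPDE Literature.Analysis.FluidPDE.TaoCascade

namespace CertificateGlueOn

variable {m : ℕ} {𝕊 : Finset (ℤ × ℤ × ℤ)} {ε₀ : ℝ} {α : Fin m → Fin m → Fin m → ℤ × ℤ × ℤ → ℝ} {Kb Ka : ℤ}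
  {Eb Et : ℝ} {M : ℤ → ℝ} {t : ℕ → ℝ} {Node Hull : ℕ → (Fin m → ℤ → ℝ) → Prop}

/-- **THE LANDING CLAUSE `hland` FROM A MESH CERTIFICATE WITH A LANDING WINDOW** (generalises
`hland_of_mesh`, whose window is the single step `ℓ`): mesh `0 = t 0 < … < t (j₂+1) ≤ c₀`, fattened core inside
`Node 0`, steps `0 … j₂` certified, a section functional `sec` continuous along window runs with `sec < lev` on
`Node j₁` and `lev ≤ sec` on `Node (j₂+1)` (`j₁ ≤ j₂`), and the STATIC READOUT CLAUSES at every state of EVERY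
hull `Hull j`, `j₁ ≤ j ≤ j₂`, on the section `{sec = lev}` ⇒ the clause `hland` verbatim. Each trajectory crosses
the section at some `τ₁ ∈ (t j₁, t (j₂+1)]` (intermediate value theorem) inside the hull of the step containing
`τ₁`; short steps across the landing window keep every `Hull j ∩ {sec = lev}` thin along the flow.
[cite: Tao2016AveragedNS, §6.3–6.4 Props. 6.4–6.5 (statement shape of a renormalisation certificate; the readout at the crossing); cell certificate format, mesh layer] -/
theorem hland_of_mesh_window {Core : (Fin m → ℤ → ℝ) → Prop} {w : ℤ → ℝ} {r ρ θ₀ σ c₀ Zx : ℝ} {i₀ : Fin m}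
    {sec : (Fin m → ℤ → ℝ) → ℝ} {lev : ℝ} {j₁ j₂ : ℕ} (hj : j₁ ≤ j₂)
    (ht0 : t 0 = 0) (hmono : ∀ j, j < j₂ + 1 → t j < t (j + 1)) (hc₀ : t (j₂ + 1) ≤ c₀)
    (hstart : ∀ (z S₀ : Fin m → ℤ → ℝ), Core z →
      (∀ i k, -Kb ≤ k → k ≤ Ka → w k * |S₀ i k - z i k| ≤ r) → Node 0 S₀)
    (hstep : ∀ j, j < j₂ + 1 → StepCert 𝕊 ε₀ α Kb Ka Eb Et M t Node Hull j)
    (hsec : ∀ (s : ℝ) (S : Fin m → ℤ → ℝ → ℝ), WindowRun 𝕊 ε₀ α Kb Ka Eb Et s S →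
      ContinuousOn (fun u => sec (slice S u)) (Icc 0 s))
    (hbefore : ∀ y, Node j₁ y → sec y < lev) (hafter : ∀ y, Node (j₂ + 1) y → lev ≤ sec y)
    (hread : ∀ j, j₁ ≤ j → j ≤ j₂ → ∀ y, Hull j y → sec y = lev →
      ∃ (a : ℝ) (z' : Fin m → ℤ → ℝ), 0 < a ∧ (1 + ε₀) ^ (-θ₀) ≤ a ∧ (1 + σ) * a ≤ |y i₀ 1| ∧ Core z' ∧
        (∀ i k, -Kb ≤ k → k + 1 ≤ Ka → w k * |y i (1 + k) / a - z' i k| ≤ ρ * r) ∧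
        (∀ (i : Fin m) (v : ℝ), |v| ≤ Et → w Ka * |v / a - z' i Ka| ≤ ρ * r) ∧
        (∀ i, |y i (-Kb)| ≤ a * Zx)) :
    ∀ (z : Fin m → ℤ → ℝ) (S : Fin m → ℤ → ℝ → ℝ), Core z →
      (∀ i k, -Kb ≤ k → k ≤ Ka → w k * |S i k 0 - z i k| ≤ r) →
      (∀ i k, -Kb ≤ k → k ≤ Ka → ∀ u ∈ Icc 0 c₀,
        HasDerivWithinAt (S i k) (quadTermOn 𝕊 ε₀ α S i k u) (Icc 0 c₀) u) →
      (∀ i, ContinuousOn (S i (-Kb - 1)) (Icc 0 c₀)) → (∀ i, ContinuousOn (S i (Ka + 1)) (Icc 0 c₀)) →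
      (∀ i, ∀ u ∈ Icc 0 c₀, |S i (-Kb - 1) u| ≤ Eb) →
      (∀ i, ∀ u ∈ Icc 0 c₀, |S i (Ka + 1) u| ≤ Et) →
      (∀ i k, -Kb ≤ k → k ≤ Ka → ∀ u ∈ Icc 0 c₀, |S i k u| ≤ M k) →
        ∃ (τ₁ a : ℝ) (z' : Fin m → ℤ → ℝ), 0 < τ₁ ∧ τ₁ ≤ c₀ ∧ 0 < a ∧ (1 + ε₀) ^ (-θ₀) ≤ a ∧
          (1 + σ) * a ≤ |S i₀ 1 τ₁| ∧ Core z' ∧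
          (∀ i k, -Kb ≤ k → k + 1 ≤ Ka → w k * |S i (1 + k) τ₁ / a - z' i k| ≤ ρ * r) ∧
          (∀ (i : Fin m) (v : ℝ), |v| ≤ Et → w Ka * |v / a - z' i Ka| ≤ ρ * r) ∧
          (∀ i, |S i (-Kb) τ₁| ≤ a * Zx) := by
  intro z S hz hball hder hcb hct hbb hbt hM
  have hrun : WindowRun 𝕊 ε₀ α Kb Ka Eb Et c₀ S := ⟨hder, hcb, hct, hbb, hbt⟩
  have h0 : Node 0 (slice S 0) := hstart z (slice S 0) hz (by simpa [slice] using hball)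
  have htnn : ∀ j, j ≤ j₂ + 1 → 0 ≤ t j := by
    intro j hj
    induction j with
    | zero => rw [ht0]
    | succ j ih => exact (ih (by omega)).trans (hmono j (by omega)).le
  have htmono : ∀ j j', j ≤ j' → j' ≤ j₂ + 1 → t j ≤ t j' := by
    intro j j' hjj' hj'
    induction j' with
    | zero => rw [Nat.le_zero.mp hjj']
    | succ j' ih =>
      rcases Nat.lt_or_ge j (j' + 1) with h | h
      · exact (ih (by omega) (by omega)).trans (hmono j' (by omega)).le
      · rw [le_antisymm hjj' h]
  have ht1 : t j₁ < t (j₂ + 1) := lt_of_le_of_lt (htmono j₁ j₂ hj (by omega)) (hmono j₂ (by omega))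
  have ht10 : 0 ≤ t j₁ := htnn j₁ (by omega)
  -- the end nodes of the landing window
  have hn1 := node_of_mesh ht0 hmono hstep hrun h0 hM j₁ (by omega) (ht1.le.trans hc₀)
  have hn2 := node_of_mesh ht0 hmono hstep hrun h0 hM (j₂ + 1) le_rfl hc₀
  -- intermediate value theorem on `[t j₁, t (j₂+1)]`
  have hcont : ContinuousOn (fun u => sec (slice S u)) (Icc (t j₁) (t (j₂ + 1))) :=
    (hsec c₀ S hrun).mono (Icc_subset_Icc ht10 hc₀)
  obtain ⟨τ₁, hτ₁, hτ₁lev⟩ :=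
    intermediate_value_Icc ht1.le hcont ⟨(hbefore _ hn1).le, hafter _ hn2⟩
  have hτ₁gt : t j₁ < τ₁ := by
    refine lt_of_le_of_ne hτ₁.1 fun h => ?_
    rw [← h] at hτ₁lev; exact (hbefore _ hn1).ne hτ₁lev
  -- the step `j ∈ [j₁, j₂]` containing `τ₁`: the first index with `τ₁ ≤ t (j+1)`
  classical
  have hex : ∃ j, τ₁ ≤ t (j + 1) := ⟨j₂, hτ₁.2⟩
  set j := Nat.find hex with hjdef
  have hju : τ₁ ≤ t (j + 1) := Nat.find_spec hex
  have hj2 : j ≤ j₂ := Nat.find_min' hex hτ₁.2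
  have hj1 : j₁ ≤ j := by
    by_contra h
    push Not at h
    have : τ₁ ≤ t j₁ := hju.trans (htmono (j + 1) j₁ (by omega) (by omega))
    linarith
  have htj : t j < τ₁ := by
    rcases Nat.eq_zero_or_pos j with h | h
    · have : j₁ = 0 := by omega
      subst this; rw [h]; exact hτ₁gt
    · have hmin := Nat.find_min hex (show j - 1 < j by omega)
      rw [Nat.sub_add_cancel h] at hmin
      push Not at hmin
      exact hmin
  have hhull : Hull j (slice S τ₁) :=
    hull_of_mesh ht0 hmono hstep hrun h0 hM (show j < j₂ + 1 by omega) (htj.trans_le (hτ₁.2.trans hc₀))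
      htj.le hju (hτ₁.2.trans hc₀)
  obtain ⟨a, z', ha, haθ, haσ, hz', hmatch, htop, hexit⟩ := hread j hj1 hj2 _ hhull hτ₁lev
  exact ⟨τ₁, a, z', lt_of_le_of_lt ht10 hτ₁gt, hτ₁.2.trans hc₀, ha, haθ, by simpa [slice] using haσ, hz',
    by simpa [slice] using hmatch, htop, by simpa [slice] using hexit⟩


end CertificateGlueOn

end Summit.NavierStokesRegularity.NavierStokesRegularity.Theorems

end
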